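import Summits.QuantumFields.BalabanUV.Beta.EriceRemainderEnclosureHistoryAutonomyComparisonIsotoneExcess

/-!
# EriceRemainderEnclosureHistoryAutonomyComparisonPrinciple — (E58a) THE COMPARISON PRINCIPLE OF THE COMPARISON COLUMN, WITH THE STEP ABSTRACTED:
# for a memory `B` with floor `b > 0` and a zeroth moment (ANY size) and a perturbation `B′ ≥ B` with a zeroth moment and an ISOTONE excess, comparison
# `h′ ≤ h` from EVERY pin follows from ONE estimate — THE STEP «under comparison from a pin, the effective β-functions are ordered at that pin»
# (`B h ≤ B′ h′` whenever `h′ ≤ h` are box solutions of `B`, `B′` from one pin) — by (E49k)'s induction down the levels; family-free when `B` is isotone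

Cell `pub-balaban`, β-function sub-cell, BINDER row D4 «RemainderConst leaves for Bałaban's split» (`HOME/BINDER-OWNERS.md`; owner lineage `b2b-balaban-beta-an4`;
this file by co-owner #2 lineage `b2b-balaban-beta-d4-p2`, generation 51), β-FLOW TEAM duty (1), FREEZE (0) honoured (def-free; (E49k)'s `family_le_of_orbit` ∕
`level_orbit_ge`, (E49j)'s `effective_le_of_small_pin`, (E48a)'s `family_mem`, (E39)'s `exists_memFlow_zm`, (E43b)'s `memFlow_unique_of_monotone_zm`, (E38a)'s
`three_sqrt_three_pos` BY NAME, nothing restated).  The induction of (E49k) `…ComparisonIsotoneExcess.effective_le_all` was re-run verbatim in (E57a)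
`…ComparisonAffine.effective_le_all_affine` and (E57b) `…ComparisonAffineMarkov.effective_le_all_dom`, each time with a different STEP estimate in place of
(E49j)(2) `effective_le_of_family_le_at` (threshold `M·γ ≤ 3√3·b`) — this file states the induction ONCE with the step as a HYPOTHESIS, so that every further
class of the comparison column (the sequel (E58b) `…ComparisonAffineProfile`: affine memories of SEVERAL ages) proves only its step.

HONEST FRAMING (page 1, verbatim and binding).  *"Discharging BetaPertH makes Bałaban's UV stability UNCONDITIONAL — a real constructive-QFT result; it is
NOT the continuum limit and NOT the Clay problem."*  THIS FILE DISCHARGES NOTHING OF THE KIND.  Elementary real analysis about ABSTRACT functionals on a box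
]0,γ]^ℕ with displayed floors, moduli and signs — hypotheses of a census, not facts; the form, signs and moments of Bałaban's (1.22) limit functional are NOT
PRINTED ([I] p. 298; GAPS G-t4-U2-1∕-2) and NOT asserted.  Row D4 class UNCHANGED (critical-path width 0; instance 0∕1; D4 DISCHARGE NO DATE).  HONEST
DEPENDENCY: continuum YM on T⁴ ⇐ BetaPertH ∧ nine spine estimates (0/9 proved); BetaPertH ⇐ (D1) ∧ (D4) ∧ CAP+tail; G-an2-4 gates asym, D1 and NE2/3/4.

THE POINT (census sense (α); the COMPARISON column of the autonomy row).  The exact criterion of (E48b) `…ComparisonCriterion` says: comparison from every pin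
⟺ the effective β-functions `Φ_B = B ∘ S_B`, `Φ_{B′} = B′ ∘ S_{B′}` are ordered.  (E49k) organises the proof of `Φ_B ≤ Φ_{B′}` as an induction down the levels
`1∕y²`: BASE — at deep levels the pin is small (`M·y ≤ (3√3∕2)·b`) and the small-pin estimate (E49j)(1) orders `Φ_B(y) ≤ Φ_{B′}(y)` outright (zeroth moment +
floor, nothing else); INDUCTION — if the effective β-functions are ordered at every orbit point `S y j`, `j ≥ 1` (one floor step deeper), then `S′ y ≤ S y` at
every scale (`family_le_of_orbit`), and THE STEP turns this comparison from the pin into the order AT the pin.  Only the step depends on the class: (E49j)(2)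
(isotone, zeroth moment `M`, threshold `M·γ ≤ 3√3·b` — SHARP by (E56b)), (E57a) §3 (one affine age, any size — acceleration lemma), (E57b) §2 (dominated single
age).  §1 here: **`effective_le_all_of_step`** — the induction with the step `hstep` as a hypothesis (families `S`, `S′` with uniqueness supplied); §2:
**`le_of_isotone_excess_of_step`** — the family-free form for ISOTONE `B` (existence (E39), uniqueness (E43b) at any size).  The sequel (E58b) feeds the step for
`b + Σ_k L_k·u_k` under a trajectory-free profile condition.

WHAT IS PROVED ([folklore]; 0 `def`, 0 sorry).  §1 **`effective_le_all_of_step`**.  §2 **`le_of_isotone_excess_of_step`**.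
-/
noncomputable section
open Finset Set

namespace Summit.QuantumFields.BalabanUV.Beta.EriceRemainderEnclosureHistoryAutonomyComparisonPrinciple

open Literature.MathematicalPhysics.QuantumFieldTheory.Balaban1983to89
open Literature.MathematicalPhysics.QuantumFieldTheory.Balaban1983to89.T4BetaStationary
open Literature.MathematicalPhysics.QuantumFieldTheory.Balaban1983to89.T4BetaFlowWellPosed
open Summit.QuantumFields.BalabanUV.Beta.EriceRemainderEnclosureHistoryAutonomyThreshold (three_sqrt_three_pos)
open Summit.QuantumFields.BalabanUV.Beta.EriceRemainderEnclosureHistoryAutonomyOrder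
open Summit.QuantumFields.BalabanUV.Beta.EriceRemainderEnclosureHistoryAutonomyComparisonExcess
open Summit.QuantumFields.BalabanUV.Beta.EriceRemainderEnclosureHistoryAutonomyComparisonIsotoneExcess
open Summit.QuantumFields.BalabanUV.Beta.EriceRemainderEnclosureHistoryAutonomyExistence (exists_memFlow_zm)
open Summit.QuantumFields.BalabanUV.Beta.EriceRemainderEnclosureHistoryAutonomyMonotoneGeneral (memFlow_unique_of_monotone_zm)

variable {B B' : (ℕ → ℝ) → ℝ} {M M' γ b y : ℝ} {h h' : ℕ → ℝ} {S S' : ℝ → ℕ → ℝ}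

/-! ## §1 The induction down the levels, with THE STEP as a hypothesis -/

/-- **THE COMPARISON PRINCIPLE (family form).**  `B` with zeroth moment `M ≥ 0` and floor `b > 0` on ]0,γ]; `B ≤ B′` on the box with ISOTONE excess
`B′ − B`; `B′` with zeroth moment `M′ ≥ 0` and floor `b′ > 0`; solution families `S`, `S′` (box solutions from every pin, unique).  Suppose THE STEP: for every
pin `y ∈ ]0,γ]` and box solutions `h`, `h′` of `B`, `B′` from `y` with `h′ ≤ h` at every scale, `B h ≤ B′ h′`.  Then the effective β-functions are ordered at
EVERY pin: `B (S y) ≤ B′ (S′ y)` — (E49k)'s induction on the number of floor steps below the level `4M²∕(27b²)` (base: the small-pin estimate (E49j)(1),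
`M·y ≤ (3√3∕2)·b`; induction: order on the orbit ⟹ comparison from the pin (`family_le_of_orbit`) ⟹ THE STEP).  NO size condition on `M` beyond what the step
itself needs. [folklore] -/
theorem effective_le_all_of_step {b' : ℝ}
    (hB : ∀ u u' : ℕ → ℝ, SeqBox γ u → SeqBox γ u' → ∀ D : ℝ, (∀ j, |u j - u' j| ≤ D) → |B u - B u'| ≤ M * D)
    (hM : 0 ≤ M) (hγ : 0 < γ) (hb : 0 < b) (hlo : ∀ u, SeqBox γ u → b ≤ B u) (hexc : ∀ u, SeqBox γ u → B u ≤ B' u)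
    (hDmono : ∀ u v : ℕ → ℝ, SeqBox γ u → SeqBox γ v → (∀ j, u j ≤ v j) → B' u - B u ≤ B' v - B v)
    (hb' : 0 < b') (hB' : ∀ u u' : ℕ → ℝ, SeqBox γ u → SeqBox γ u' → ∀ D : ℝ, (∀ j, |u j - u' j| ≤ D) → |B' u - B' u'| ≤ M' * D)
    (hM' : 0 ≤ M') (hlo' : ∀ u, SeqBox γ u → b' ≤ B' u)
    (hS : ∀ p, 0 < p → p ≤ γ → SeqBox γ (S p) ∧ MemFlow B p (S p))
    (huniq : ∀ p, 0 < p → p ≤ γ → ∀ u u' : ℕ → ℝ, SeqBox γ u → SeqBox γ u' → MemFlow B p u → MemFlow B p u' → u = u')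
    (hS' : ∀ p, 0 < p → p ≤ γ → SeqBox γ (S' p) ∧ MemFlow B' p (S' p))
    (huniq' : ∀ p, 0 < p → p ≤ γ → ∀ u u' : ℕ → ℝ, SeqBox γ u → SeqBox γ u' → MemFlow B' p u → MemFlow B' p u' → u = u')
    (hstep : ∀ y, 0 < y → y ≤ γ → ∀ h h' : ℕ → ℝ, SeqBox γ h → MemFlow B y h → SeqBox γ h' → MemFlow B' y h' →
      (∀ j, h' j ≤ h j) → B h ≤ B' h') :
    ∀ y, 0 < y → y ≤ γ → B (S y) ≤ B' (S' y) := by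
  have h33 : 0 < 3 * Real.sqrt 3 := three_sqrt_three_pos
  have hsq3 : Real.sqrt 3 ^ 2 = 3 := Real.sq_sqrt (by norm_num)
  -- the level threshold Λ = 4M²/(27 b²): 1/y² ≥ Λ ⟹ M·y ≤ (3√3/2)·b
  set Λ : ℝ := 4 * M ^ 2 / (27 * b ^ 2) with hΛ_def
  have hbase : ∀ y, 0 < y → y ≤ γ → Λ ≤ 1 / y ^ 2 → B (S y) ≤ B' (S' y) := by
    intro y hy hyγ hlev
    have hMy : M * y ≤ 3 * Real.sqrt 3 / 2 * b := by
      have hy2 : 0 < y ^ 2 := by positivity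
      have k1 : 4 * M ^ 2 ≤ 1 / y ^ 2 * (27 * b ^ 2) := (div_le_iff₀ (by positivity : (0:ℝ) < 27 * b ^ 2)).mp hlev
      have k2 := mul_le_mul_of_nonneg_right k1 hy2.le
      have e : 1 / y ^ 2 * (27 * b ^ 2) * y ^ 2 = 27 * b ^ 2 := by field_simp
      rw [e] at k2
      have h1 : (2 * M * y) ^ 2 ≤ (3 * Real.sqrt 3 * b) ^ 2 := by nlinarith [hsq3, k2]
      have h2 : 2 * M * y ≤ 3 * Real.sqrt 3 * b := (sq_le_sq₀ (by positivity) (by positivity)).mp h1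
      linarith
    exact effective_le_of_small_pin hB hM hb hlo hexc hDmono hy hyγ hMy (hS y hy hyγ).1 (hS y hy hyγ).2 (hS' y hy hyγ).1 (hS' y hy hyγ).2
  -- induction on the number of floor steps below the threshold level
  have hind : ∀ n : ℕ, ∀ y, 0 < y → y ≤ γ → Λ - (n : ℝ) * b ≤ 1 / y ^ 2 → B (S y) ≤ B' (S' y) := by
    intro n
    induction n with
    | zero => intro y hy hyγ hlev; exact hbase y hy hyγ (by simpa using hlev)
    | succ n ih =>
      intro y hy hyγ hlev
      have hy' : y ∈ Ioc (0 : ℝ) γ := ⟨hy, hyγ⟩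
      have hQ : ∀ j, 1 ≤ j → B (S (S y j)) ≤ B' (S' (S y j)) := by
        intro j hj
        have hm := family_mem hS hy hyγ j
        refine ih (S y j) hm.1 hm.2 ?_
        have := level_orbit_ge hb hlo hS hy' hj
        rw [Nat.cast_succ] at hlev
        linarith
      have hcomp := family_le_of_orbit hb' hγ hB' hM' hlo' hS huniq hS' huniq' hy' hQ
      exact hstep y hy hyγ _ _ (hS y hy hyγ).1 (hS y hy hyγ).2 (hS' y hy hyγ).1 (hS' y hy hyγ).2 hcomp
  intro y hy hyγ
  obtain ⟨n, hn⟩ : ∃ n : ℕ, Λ / b ≤ n := exists_nat_ge (Λ / b)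
  refine hind n y hy hyγ ?_
  have : Λ ≤ (n : ℝ) * b := by rw [div_le_iff₀ hb] at hn; linarith
  have : 0 ≤ 1 / y ^ 2 := by positivity
  linarith

/-! ## §2 The family-free form for an ISOTONE memory -/

/-- **THE COMPARISON PRINCIPLE (family-free form).**  `B` ISOTONE on ]0,γ] with floor `b > 0` and zeroth moment `M ≥ 0` (ANY size); `B′` with zeroth moment
`M′ ≥ 0`, `B ≤ B′` on the box, and the EXCESS `B′ − B` ISOTONE; THE STEP as in §1.  Then for ANY box solutions `h`, `h′` of `B`, `B′` from one pin `p ∈ ]0,γ]`: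
`h′ ≤ h` at EVERY scale.  (Existence of the two solution families: (E39) `exists_memFlow_zm`; uniqueness at any size: (E43b) `memFlow_unique_of_monotone_zm`
for `B` and for `B′` — isotone as the sum of `B` and an isotone excess; then §1 and `family_le_of_orbit`.)  The three comparison theorems of the column are the
instances STEP = (E49j)(2) (threshold `3√3`), (E57a) §3, (E57b) §2; (E58b) adds affine memories of several ages. [folklore] -/
theorem le_of_isotone_excess_of_step {p : ℝ}
    (hmono : ∀ u v : ℕ → ℝ, SeqBox γ u → SeqBox γ v → (∀ j, u j ≤ v j) → B u ≤ B v)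
    (hB : ∀ u u' : ℕ → ℝ, SeqBox γ u → SeqBox γ u' → ∀ D : ℝ, (∀ j, |u j - u' j| ≤ D) → |B u - B u'| ≤ M * D)
    (hM : 0 ≤ M) (hb : 0 < b) (hlo : ∀ u, SeqBox γ u → b ≤ B u)
    (hB' : ∀ u u' : ℕ → ℝ, SeqBox γ u → SeqBox γ u' → ∀ D : ℝ, (∀ j, |u j - u' j| ≤ D) → |B' u - B' u'| ≤ M' * D) (hM' : 0 ≤ M')
    (hexc : ∀ u, SeqBox γ u → B u ≤ B' u)
    (hDmono : ∀ u v : ℕ → ℝ, SeqBox γ u → SeqBox γ v → (∀ j, u j ≤ v j) → B' u - B u ≤ B' v - B v)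
    (hstep : ∀ y, 0 < y → y ≤ γ → ∀ h h' : ℕ → ℝ, SeqBox γ h → MemFlow B y h → SeqBox γ h' → MemFlow B' y h' →
      (∀ j, h' j ≤ h j) → B h ≤ B' h')
    (hp : 0 < p) (hpγ : p ≤ γ) (hh : SeqBox γ h) (hf : MemFlow B p h) (hh' : SeqBox γ h') (hf' : MemFlow B' p h') (j : ℕ) :
    h' j ≤ h j := by
  have hγ : 0 < γ := hp.trans_le hpγ
  have hlo' : ∀ u, SeqBox γ u → b ≤ B' u := fun u hu => (hlo u hu).trans (hexc u hu)
  have hmono' : ∀ u v : ℕ → ℝ, SeqBox γ u → SeqBox γ v → (∀ j, u j ≤ v j) → B' u ≤ B' v := fun u v hu hv huv => by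
    have := hDmono u v hu hv huv; have := hmono u v hu hv huv; linarith
  -- the two solution families
  have hex : ∀ q : ℝ, 0 < q → q ≤ γ → ∃ k : ℕ → ℝ, SeqBox γ k ∧ MemFlow B q k := fun q hq hqγ => exists_memFlow_zm hB hM hq hqγ hb hlo
  have hex' : ∀ q : ℝ, 0 < q → q ≤ γ → ∃ k : ℕ → ℝ, SeqBox γ k ∧ MemFlow B' q k := fun q hq hqγ => exists_memFlow_zm hB' hM' hq hqγ hb hlo'
  choose! S hSb hSf using hex
  choose! S' hS'b hS'f using hex'
  have hS : ∀ q, 0 < q → q ≤ γ → SeqBox γ (S q) ∧ MemFlow B q (S q) := fun q hq hqγ => ⟨hSb q hq hqγ, hSf q hq hqγ⟩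
  have hS' : ∀ q, 0 < q → q ≤ γ → SeqBox γ (S' q) ∧ MemFlow B' q (S' q) := fun q hq hqγ => ⟨hS'b q hq hqγ, hS'f q hq hqγ⟩
  have huniq : ∀ q, 0 < q → q ≤ γ → ∀ u u' : ℕ → ℝ, SeqBox γ u → SeqBox γ u' → MemFlow B q u → MemFlow B q u' → u = u' :=
    fun q hq _ u u' hu hu' hfu hfu' => memFlow_unique_of_monotone_zm hmono hB hM hq hb hlo hu hu' hfu hfu'
  have huniq' : ∀ q, 0 < q → q ≤ γ → ∀ u u' : ℕ → ℝ, SeqBox γ u → SeqBox γ u' → MemFlow B' q u → MemFlow B' q u' → u = u' :=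
    fun q hq _ u u' hu hu' hfu hfu' => memFlow_unique_of_monotone_zm hmono' hB' hM' hq hb hlo' hu hu' hfu hfu'
  have e : h = S p := huniq p hp hpγ _ _ hh (hS p hp hpγ).1 hf (hS p hp hpγ).2
  have e' : h' = S' p := huniq' p hp hpγ _ _ hh' (hS' p hp hpγ).1 hf' (hS' p hp hpγ).2
  rw [e, e']
  exact family_le_of_orbit hb hγ hB' hM' hlo' hS huniq hS' huniq' ⟨hp, hpγ⟩ (fun i _ =>
    effective_le_all_of_step hB hM hγ hb hlo hexc hDmono hb hB' hM' hlo' hS huniq hS' huniq' hstep _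
      (family_mem hS hp hpγ i).1 (family_mem hS hp hpγ i).2) j

end Summit.QuantumFields.BalabanUV.Beta.EriceRemainderEnclosureHistoryAutonomyComparisonPrinciple

end
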